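import Mathlib
import Literature.Combinatorics.Additive.TripleProductProperty
import Summits.MatrixMultiplication.MatrixMultiplication.Theorems.GroupTheoreticSTPPCThesisFatPartnersBasic
import Summits.MatrixMultiplication.MatrixMultiplication.Theorems.GroupTheoreticSTPPCThesisFatPartnersLines
import Summits.MatrixMultiplication.MatrixMultiplication.Theorems.GroupTheoreticSTPPCThesisFatPartnersLinesStep3
import Summits.MatrixMultiplication.MatrixMultiplication.Theorems.GroupTheoreticSTPPCThesisFatPartnersPairLemma

/-!
# Fat-partner rigidity: the `(n−1)³`-shaped partners of the axes triple are the CKSU translates (`n ≥ 6`)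

Support file for route `MatrixMultiplication/GroupTheoreticSTPP` (target `CThesis`, stmt-MatrixMultiplication-0593),
cell `mm-stpp` (D-0046), theory statement S9 (HOME/mm-stpp-theory/FAT-PARTNERS.md; hand proof there, kit
enumeration for `n ≤ 7`).  Assembly of `…FatPartnersBasic.lean` (the seven constraints extracted from the
STPP), `…FatPartnersLines.lean` (STEPS 2, 4), `…FatPartnersLinesStep3.lean` (STEP 3) and
`…FatPartnersPairLemma.lean` (STEP 0 and the volume bound):

**Theorem (`fat_partner_rigidity`).**  Let `n ≥ 6` and let a two-member family in `(ℤ/n)³` consist of the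
punctured-axes triple `(P₀, P₁, P₂)` (member `0`) and a triple `(A 1, B 1, C 1)` with
`|A 1| = |B 1| = |C 1| = n − 1` (member `1`).  If the family has the simultaneous triple product property,
then for some `t = (t₀, t₁, t₂)` either `(A 1, B 1, C 1) = (P₁ + t, P₂ + t, P₀ + t)` or
`(A 1, B 1, C 1) = (P₂ + t, P₀ + t, P₁ + t)` (as membership descriptions).  The cases "`B 1` is a line" and
"`C 1` is a line" are the case "`A 1` is a line" for the cyclically renamed constraint system.

WHAT THIS IS NOT: for `n ≤ 5` the statement rests on exhaustive enumeration (cell census); the corollary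
«an STPP family of `(n−1)³`-shaped triples containing a frame triple has at most two members» is the
sequel; nothing here is an `ω` claim.

## References
* H. Cohn, R. Kleinberg, B. Szegedy, C. Umans, FOCS 2005, Def. 5.1, Prop. 5.2.
-/

-- single-conjunct summit: the mandated namespace repeats `MatrixMultiplication`.
set_option linter.dupNamespace false

namespace Summit.MatrixMultiplication.MatrixMultiplication.Theorems

namespace FatPartners

open Finset Literature.Combinatorics.Additive

variable {n : ℕ} [NeZero n] {A B C : Fin 2 → Finset (Fin 3 → ZMod n)}

/-- **Fat-partner rigidity** (`n ≥ 6`): an `(n−1)³`-shaped STPP partner of the punctured-axes triple of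
`(ℤ/n)³` is a common translate of `(P₁, P₂, P₀)` or of `(P₂, P₀, P₁)`.
[cite: CohnKleinbergSzegedyUmans2005, Def. 5.1 and Prop. 5.2] -/
theorem fat_partner_rigidity (hn : 6 ≤ n)
    (hA0 : ∀ x, x ∈ A 0 ↔ x 0 ≠ 0 ∧ ∀ j, j ≠ 0 → x j = 0)
    (hB0 : ∀ x, x ∈ B 0 ↔ x 1 ≠ 0 ∧ ∀ j, j ≠ 1 → x j = 0)
    (hC0 : ∀ x, x ∈ C 0 ↔ x 2 ≠ 0 ∧ ∀ j, j ≠ 2 → x j = 0)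
    (hS : AddSimultaneousTPP A B C)
    (hAc : (A 1).card = n - 1) (hBc : (B 1).card = n - 1) (hCc : (C 1).card = n - 1) :
    ∃ t₀ t₁ t₂ : ZMod n,
      ((∀ v, v ∈ A 1 ↔ v 0 = t₀ ∧ v 2 = t₂ ∧ v 1 ≠ t₁) ∧ (∀ v, v ∈ B 1 ↔ v 0 = t₀ ∧ v 1 = t₁ ∧ v 2 ≠ t₂) ∧
        (∀ v, v ∈ C 1 ↔ v 1 = t₁ ∧ v 2 = t₂ ∧ v 0 ≠ t₀)) ∨
      ((∀ v, v ∈ A 1 ↔ v 0 = t₀ ∧ v 1 = t₁ ∧ v 2 ≠ t₂) ∧ (∀ v, v ∈ B 1 ↔ v 1 = t₁ ∧ v 2 = t₂ ∧ v 0 ≠ t₀) ∧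
        (∀ v, v ∈ C 1 ↔ v 0 = t₀ ∧ v 2 = t₂ ∧ v 1 ≠ t₁)) := by
  have hn3 : 3 ≤ n := by omega
  have hn4 : 4 ≤ n := by omega
  -- the seven constraints, in the three cyclic namings
  have fXY : ∀ a ∈ A 1, ∀ b ∈ B 1, a 0 = b 0 ∨ a 1 = b 1 := fun a ha b hb => fAB hn3 hA0 hB0 hC0 hS ha hb
  have fYZ : ∀ b ∈ B 1, ∀ c ∈ C 1, b 1 = c 1 ∨ b 2 = c 2 := fun b hb c hc => fBC hn3 hA0 hB0 hC0 hS hb hc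
  have fZX : ∀ c ∈ C 1, ∀ a ∈ A 1, c 2 = a 2 ∨ c 0 = a 0 :=
    fun c hc a ha => (fCA hn3 hA0 hB0 hC0 hS hc ha).symm
  have gX : ∀ a ∈ A 1, ∀ a' ∈ A 1, ∀ b ∈ B 1, ∀ c' ∈ C 1,
      (a - a' + (b - c')) 1 = 0 ∨ (a - a' + (b - c')) 2 = 0 ∨ (a - a' + (b - c')) 0 ≠ 0 :=
    fun a ha a' ha' b hb c' hc' => gA hB0 hC0 hS ha ha' hb hc'
  have gY : ∀ b ∈ B 1, ∀ b' ∈ B 1, ∀ c ∈ C 1, ∀ a' ∈ A 1,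
      (b - b' + (c - a')) 2 = 0 ∨ (b - b' + (c - a')) 0 = 0 ∨ (b - b' + (c - a')) 1 ≠ 0 := by
    intro b hb b' hb' c hc a' ha'
    rcases gB hA0 hC0 hS hb hb' hc ha' with h | h | h
    · exact Or.inr (Or.inl h)
    · exact Or.inl h
    · exact Or.inr (Or.inr h)
  have gZ : ∀ c ∈ C 1, ∀ c' ∈ C 1, ∀ a ∈ A 1, ∀ b' ∈ B 1,
      (c - c' + (a - b')) 0 = 0 ∨ (c - c' + (a - b')) 1 = 0 ∨ (c - c' + (a - b')) 2 ≠ 0 :=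
    fun c hc c' hc' a ha b' hb' => gC hA0 hB0 hS hc hc' ha hb'
  have hinj : ∀ a ∈ A 1, ∀ a' ∈ A 1, ∀ b ∈ B 1, ∀ b' ∈ B 1, ∀ c ∈ C 1, ∀ c' ∈ C 1,
      a + b + c = a' + b' + c' → a = a' ∧ b = b' ∧ c = c' :=
    fun a ha a' ha' b hb b' hb' c hc c' hc' h => sum_injective hS ha ha' hb hb' hc hc' h
  have hinj₁ : ∀ b ∈ B 1, ∀ b' ∈ B 1, ∀ c ∈ C 1, ∀ c' ∈ C 1, ∀ a ∈ A 1, ∀ a' ∈ A 1,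
      b + c + a = b' + c' + a' → b = b' ∧ c = c' ∧ a = a' := by
    intro b hb b' hb' c hc c' hc' a ha a' ha' h
    have h' : a + b + c = a' + b' + c' := by rw [← sub_eq_zero] at h ⊢; rw [← h]; abel
    obtain ⟨e1, e2, e3⟩ := hinj a ha a' ha' b hb b' hb' c hc c' hc' h'
    exact ⟨e2, e3, e1⟩
  have hinj₂ : ∀ c ∈ C 1, ∀ c' ∈ C 1, ∀ a ∈ A 1, ∀ a' ∈ A 1, ∀ b ∈ B 1, ∀ b' ∈ B 1,
      c + a + b = c' + a' + b' → c = c' ∧ a = a' ∧ b = b' := by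
    intro c hc c' hc' a ha a' ha' b hb b' hb' h
    have h' : a + b + c = a' + b' + c' := by rw [← sub_eq_zero] at h ⊢; rw [← h]; abel
    obtain ⟨e1, e2, e3⟩ := hinj a ha a' ha' b hb b' hb' c hc c' hc' h'
    exact ⟨e3, e1, e2⟩
  have cov₀ : ∀ i : Fin 3, i = 0 ∨ i = 1 ∨ i = 2 := by decide
  have cov₁ : ∀ i : Fin 3, i = 1 ∨ i = 2 ∨ i = 0 := by decide
  have cov₂ : ∀ i : Fin 3, i = 2 ∨ i = 0 ∨ i = 1 := by decide
  obtain ⟨a₀, ha₀⟩ : (A 1).Nonempty := by rw [← Finset.card_pos, hAc]; omega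
  obtain ⟨b₀, hb₀⟩ : (B 1).Nonempty := by rw [← Finset.card_pos, hBc]; omega
  obtain ⟨c₀, hc₀⟩ : (C 1).Nonempty := by rw [← Finset.card_pos, hCc]; omega
  -- shorthand for the goal
  suffices goal : (∃ α β : ZMod n, ∀ a ∈ A 1, a 0 = α ∧ a 2 = β) ∨
      (∃ α β : ZMod n, ∀ a ∈ A 1, a 0 = α ∧ a 1 = β) ∨
      (∃ α β : ZMod n, ∀ b ∈ B 1, b 1 = α ∧ b 0 = β) ∨ (∃ α β : ZMod n, ∀ b ∈ B 1, b 1 = α ∧ b 2 = β) ∨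
      (∃ α β : ZMod n, ∀ c ∈ C 1, c 2 = α ∧ c 1 = β) ∨ (∃ α β : ZMod n, ∀ c ∈ C 1, c 2 = α ∧ c 0 = β) by
    rcases goal with ⟨α, β, hl⟩ | ⟨α, β, hl⟩ | ⟨α, β, hl⟩ | ⟨α, β, hl⟩ | ⟨α, β, hl⟩ | ⟨α, β, hl⟩
    · -- `A 1 ∥ e₁`: shape `rot`, naming `(A,B,C,0,1,2)`
      obtain ⟨bq, cq, cr, hYl, hZl⟩ :=
        lines_of_line_q hn4 cov₀ fXY fYZ fZX gX gZ hinj hAc hBc hCc hl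
      obtain ⟨-, -, -, hA, hB, hC⟩ :=
        partner_of_lines_rot hn3 cov₀ fXY fYZ fZX gX gY gZ hAc hBc hCc hl hYl hZl
      exact ⟨α, bq, β, Or.inl ⟨hA, hB, hC⟩⟩
    · -- `A 1 ∥ e₂`: shape `rot²`
      obtain ⟨bq, br, cr, hYl, hZl⟩ :=
        lines_of_line_r hn4 cov₀ fXY fYZ fZX gX gY hinj hAc hBc hCc hl
      obtain ⟨-, -, -, hA, hB, hC⟩ :=
        partner_of_lines_rot2 hn3 cov₀ fXY fYZ fZX gX gY gZ hAc hBc hCc hl hYl hZl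
      exact ⟨α, β, br, Or.inr ⟨hA, hB, hC⟩⟩
    · -- `B 1 ∥ e₂`: shape `rot`, naming `(B,C,A,1,2,0)`
      obtain ⟨bq, cq, cr, hYl, hZl⟩ :=
        lines_of_line_q hn4 cov₁ fYZ fZX fXY gY gX hinj₁ hBc hCc hAc hl
      obtain ⟨-, -, -, hB, hC, hA⟩ :=
        partner_of_lines_rot hn3 cov₁ fYZ fZX fXY gY gZ gX hBc hCc hAc hl hYl hZl
      refine ⟨β, α, bq, Or.inl ⟨fun v => (hA v).trans (by tauto), fun v => (hB v).trans (by tauto),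
        fun v => (hC v).trans (by tauto)⟩⟩
    · -- `B 1 ∥ e₀`: shape `rot²`, naming `(B,C,A,1,2,0)`
      obtain ⟨bq, br, cr, hYl, hZl⟩ :=
        lines_of_line_r hn4 cov₁ fYZ fZX fXY gY gZ hinj₁ hBc hCc hAc hl
      obtain ⟨-, -, -, hB, hC, hA⟩ :=
        partner_of_lines_rot2 hn3 cov₁ fYZ fZX fXY gY gZ gX hBc hCc hAc hl hYl hZl
      refine ⟨br, α, β, Or.inr ⟨fun v => (hA v).trans (by tauto), fun v => (hB v).trans (by tauto),
        fun v => (hC v).trans (by tauto)⟩⟩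
    · -- `C 1 ∥ e₀`: shape `rot`, naming `(C,A,B,2,0,1)`
      obtain ⟨bq, cq, cr, hYl, hZl⟩ :=
        lines_of_line_q hn4 cov₂ fZX fXY fYZ gZ gY hinj₂ hCc hAc hBc hl
      obtain ⟨-, -, -, hC, hA, hB⟩ :=
        partner_of_lines_rot hn3 cov₂ fZX fXY fYZ gZ gX gY hCc hAc hBc hl hYl hZl
      refine ⟨bq, β, α, Or.inl ⟨fun v => (hA v).trans (by tauto), fun v => (hB v).trans (by tauto),
        fun v => (hC v).trans (by tauto)⟩⟩
    · -- `C 1 ∥ e₁`: shape `rot²`, naming `(C,A,B,2,0,1)`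
      obtain ⟨bq, br, cr, hYl, hZl⟩ :=
        lines_of_line_r hn4 cov₂ fZX fXY fYZ gZ gX hinj₂ hCc hAc hBc hl
      obtain ⟨-, -, -, hC, hA, hB⟩ :=
        partner_of_lines_rot2 hn3 cov₂ fZX fXY fYZ gZ gX gY hCc hAc hBc hl hYl hZl
      refine ⟨β, br, α, Or.inr ⟨fun v => (hA v).trans (by tauto), fun v => (hB v).trans (by tauto),
        fun v => (hC v).trans (by tauto)⟩⟩
  -- STEP 1: some set is a line (pair lemma for the three pairs + volume bound)
  have hsAB : ∀ a ∈ A 1, ∀ a' ∈ A 1, ∀ b ∈ B 1, ∀ b' ∈ B 1, a + b = a' + b' → a = a' ∧ b = b' := by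
    intro a ha a' ha' b hb b' hb' h
    obtain ⟨e1, e2, -⟩ := hinj a ha a' ha' b hb b' hb' c₀ hc₀ c₀ hc₀ (by rw [h])
    exact ⟨e1, e2⟩
  have hsBC : ∀ b ∈ B 1, ∀ b' ∈ B 1, ∀ c ∈ C 1, ∀ c' ∈ C 1, b + c = b' + c' → b = b' ∧ c = c' := by
    intro b hb b' hb' c hc c' hc' h
    obtain ⟨e1, e2, -⟩ := hinj₁ b hb b' hb' c hc c' hc' a₀ ha₀ a₀ ha₀ (by rw [h])
    exact ⟨e1, e2⟩
  have hsCA : ∀ c ∈ C 1, ∀ c' ∈ C 1, ∀ a ∈ A 1, ∀ a' ∈ A 1, c + a = c' + a' → c = c' ∧ a = a' := by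
    intro c hc c' hc' a ha a' ha' h
    obtain ⟨e1, e2, -⟩ := hinj₂ c hc c' hc' a ha a' ha' b₀ hb₀ b₀ hb₀ (by rw [h])
    exact ⟨e1, e2⟩
  have PL₀ := pair_lemma hn cov₀ fXY hsAB hAc hBc
  have PL₁ := pair_lemma hn cov₁ fYZ hsBC hBc hCc
  have PL₂ := pair_lemma hn cov₂ fZX hsCA hCc hAc
  -- dispatch
  rcases PL₀ with ⟨u, hAu, hBu⟩ | ⟨u, hAu, hBu⟩ | hBline | hAline
  · -- (a): `A, B` constant `= u` in coordinate `0`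
    rcases PL₂ with ⟨w, hCw, hAw⟩ | ⟨w, hCw, hAw⟩ | hAline | hCline
    · -- `C, A` constant in coordinate `2`: `A ∥ e₁`
      exact Or.inl ⟨u, w, fun a ha => ⟨hAu a ha, hAw a ha⟩⟩
    · -- `C, A` constant in coordinate `0`: coordinate `0` constant on all three
      exact (not_all_const hn4 cov₀ hinj hAc hBc hCc hAu hBu hCw).elim
    · -- `A ∥ e₁`
      obtain ⟨α, β, hl⟩ := hAline
      exact Or.inl ⟨β, α, fun a ha => ⟨(hl a ha).2, (hl a ha).1⟩⟩
    · -- `C ∥ e₁`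
      exact Or.inr (Or.inr (Or.inr (Or.inr (Or.inr hCline))))
  · -- (b): `A, B` constant `= u` in coordinate `1`
    rcases PL₁ with ⟨v, hBv, hCv⟩ | ⟨v, hBv, hCv⟩ | hCline | hBline
    · -- `B, C` constant in coordinate `1`: all three constant in coordinate `1`
      exact (not_all_const hn4 cov₁ hinj hAc hBc hCc hAu hBu hCv).elim
    · -- `B, C` constant in coordinate `2`: `B ∥ e₀`
      exact Or.inr (Or.inr (Or.inr (Or.inl ⟨u, v, fun b hb => ⟨hBu b hb, hBv b hb⟩⟩)))
    · -- `C ∥ e₀` (constant in coordinates `1, 2`)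
      obtain ⟨α, β, hl⟩ := hCline
      exact Or.inr (Or.inr (Or.inr (Or.inr (Or.inl ⟨β, α, fun c hc => ⟨(hl c hc).2, (hl c hc).1⟩⟩))))
    · -- `B ∥ e₀`
      exact Or.inr (Or.inr (Or.inr (Or.inl hBline)))
  · -- (c): `B 1` constant in coordinates `0, 1`: `B ∥ e₂`
    obtain ⟨α, β, hl⟩ := hBline
    exact Or.inr (Or.inr (Or.inl ⟨β, α, fun b hb => ⟨(hl b hb).2, (hl b hb).1⟩⟩))
  · -- (c′): `A 1` constant in coordinates `0, 1`: `A ∥ e₂`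
    exact Or.inr (Or.inl hAline)

end FatPartners

end Summit.MatrixMultiplication.MatrixMultiplication.Theorems
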